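import Summits.HodgeConjecture.HodgeConjecture.Theorems.F0P3cStCharTSHCDescentSemisimpleAssembly   -- (this seat) ★ FINAL assembly: `exists_nhds_setLIntegral_etaInv_lt_top_of_normalFormBasis`
import Summits.HodgeConjecture.HodgeConjecture.Theorems.F0P3cStCharTSHCDLieGlobalDescent         -- ★ (F0P3a-p07) DESCENT `↥𝔲 ⇒ ↥𝔲₀`: `exists_nhds_setLIntegral_etaInv_lt_top_traceZero_of_lie`
import Literature.LinearAlgebra.Matrix.SkewHermitianTypeAABNormalForm                            -- ★ p852234 (LH10-p01) (ii-B): `exists_isUnit_conj_eq_diagonal_and_congr_diagonal`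
import HarnessLib

/-!
# F0 · P3c · line LH6 «StCharTS» — ROAD «HC-D», brick (D5ii) «SEMISIMPLE DESCENT AT TYPE (a,a,b)» — THE DISCHARGED HEADS
# (`hss` of ★ GLOBAL-FINAL, on `↥𝔲` and on the trace-zero part `↥𝔲₀`)

Cell `pub/hodgecm-mathlib`, crux H413 = `stmt-HodgeConjecture-24833` (lane `--supports … --as helper`), route HCCMUnconditional; seat F0P3a-p05 (g23); dealer F0P2-p01 (g23).
THEOREMS ONLY (no definition ∕ instance ∕ notation ∕ named fact ∕ `sorry`); ★-only imports: FINAL assembly (this seat), DESCENT (F0P3a-p07), (ii-B) (LH10-p01).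
HONEST LABEL: HC_CM is proved only modulo the 7 printed citations (2 remaining: hLiu418 = `stmt-HodgeConjecture-24832`, h413 = `stmt-HodgeConjecture-24833`) until rung 0
closes; count-neutral analysis for the named input (HC-D) «`|D_G|^{−1∕2} ∈ L¹_loc(G)`» [HarishChandra1970, Part VII §1 Thm. 15]; closes no organ.

WHAT IT DOES.  ★ (ii-B) `exists_isUnit_conj_eq_diagonal_and_congr_diagonal` supplies, for a non-scalar `J`-skew `X₀` with `(X₀ − a)(X₀ − b) = 0`, `a ≠ b` (`J` hermitian with unit
determinant, `σ` an involution, `2` invertible), a basis `g` with `g⁻¹ X₀ g = diagonal ![a,a,b]` or `diagonal ![b,b,a]` and `ᵗ(σg) J g = diagonal d` (`d` `σ`-fixed, invertible);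
★ FINAL assembly `exists_nhds_setLIntegral_etaInv_lt_top_of_normalFormBasis` (applied with `(a,b)` or `(b,a)`) gives **`exists_nhds_setLIntegral_etaInv_lt_top_of_isSplitSemisimple`**:
`∃ U ∈ 𝓝 X₀, ∫⁻ X in U, ηι X ∂μ < ∞` on `↥𝔲` (ANY Borel structure, ANY additive Haar `μ`); ★ DESCENT `exists_nhds_setLIntegral_etaInv_lt_top_traceZero_of_lie` carries it to
the trace-zero part: **`forall_exists_nhds_setLIntegral_etaInv_lt_top_traceZero_of_isSplitSemisimple`** = the `hss` binder of ★ `…HCDLieGlobalFinal.forall_exists_nhds_setLIntegral_etaInv_lt_top_of_cusp`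
TOKEN FOR TOKEN.

## References
* [HarishChandra1970] Harish-Chandra (notes by G. van Dijk), *Harmonic Analysis on Reductive p-adic Groups*, LNM 162 (1970), Part VI Lemma 22; Part VII §1 Thm. 15.
* [Rogawski1990] J. D. Rogawski, *Automorphic Representations of Unitary Groups in Three Variables*, Ann. of Math. Stud. 123 (1990), §3.6 pp. 28–31; §12.5 p. 184.
* [Folland1999] G. B. Folland, *Real Analysis* (2nd ed., 1999), §11.1 Thm. 11.9.
-/

set_option autoImplicit false
-- the mandated namespace has the single-problem summit's repeated segment (`HodgeConjecture.HodgeConjecture`)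
set_option linter.dupNamespace false

noncomputable section

open MeasureTheory MeasureTheory.Measure Filter Topology Set Matrix
open scoped NNReal ENNReal Matrix
open Literature.NumberTheory.GaloisRepresentations Literature.LinearAlgebra.Matrix
open Summit.HodgeConjecture.HodgeConjecture.Cruxes.H413.F0P3cStCharTSHCDescentSemisimpleAssembly
open Summit.HodgeConjecture.HodgeConjecture.Cruxes.H413.F0P3cStCharTSHCDLieGlobalDescent

namespace Summit.HodgeConjecture.HodgeConjecture.Cruxes.H413.F0P3cStCharTSHCDescentSemisimpleFinal

variable {K : Type*} [Field K] [ValuativeRel K] [TopologicalSpace K] [IsNonarchimedeanLocalField K] [CharZero K]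

/-- **SEMISIMPLE DESCENT AT A SPLIT-SEMISIMPLE NON-REGULAR POINT OF `↥𝔲`** (ROAD «HC-D», brick (D5ii), discharged).  Road frame: `σ` a continuous involution of the
char-0 non-archimedean local field `K` with fixed field the closed-embedded local field `ι : F′ → K` (norm bridge `|ι x|_K = |x|²_{F′}`), `lam` a skew unit, `2 ≠ 0`;
`J` `σ`-hermitian with `det J` a unit; `𝔲 = 𝔲(J)` with ANY Borel structure and ANY additive Haar measure `μ`.  If `X₀ ∈ 𝔲` is split semisimple non-scalar —
`∃ a ≠ b, (X₀ − a)(X₀ − b) = 0` and `X₀ ≠ c • 1` for all `c` — then `ηι X = (↑√√|disc χ_X|_K)⁻¹` has finite `∫⁻` on a neighbourhood of `X₀` in `↥𝔲`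
(★ (ii-B) normal-form basis ∘ ★ FINAL assembly).
[cite: HarishChandra1970, Part VI Lemma 22; Part VII §1 Thm. 15] [cite: Rogawski1990, §3.6 pp. 28–31; §12.5 p. 184] [cite: Folland1999, §11.1 Thm. 11.9] -/
theorem exists_nhds_setLIntegral_etaInv_lt_top_of_isSplitSemisimple
    (σ : K →+* K) (hσ : ∀ x, σ (σ x) = x) (hσc : Continuous σ)
    {J : Matrix (Fin 3) (Fin 3) K} (hJσ : (J.map σ)ᵀ = J) (hJd : IsUnit J.det) (h2 : (2 : K) ≠ 0)
    (lam : Kˣ) (hlam : σ (lam : K) = -(lam : K))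
    (𝔲 : AddSubgroup (Matrix (Fin 3) (Fin 3) K)) (h𝔲 : ∀ X, X ∈ 𝔲 ↔ (X.map σ)ᵀ * J + J * X = 0)
    [MeasurableSpace ↥𝔲] [BorelSpace ↥𝔲] (μ : Measure ↥𝔲) [μ.IsAddHaarMeasure]
    {F' : Type*} [Field F'] [ValuativeRel F'] [TopologicalSpace F'] [IsNonarchimedeanLocalField F']
    (ι : F' →+* K) (hι : IsClosedEmbedding ι) (hιr : ∀ x, σ x = x ↔ x ∈ Set.range ι)
    (hιn : ∀ x : F', IsNonarchimedeanLocalField.normAbs K (ι x) = IsNonarchimedeanLocalField.normAbs F' x ^ 2)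
    (X₀ : ↥𝔲)
    (hss : ∃ a b : K, a ≠ b ∧ ((X₀ : Matrix (Fin 3) (Fin 3) K) - a • (1 : Matrix (Fin 3) (Fin 3) K)) * ((X₀ : Matrix (Fin 3) (Fin 3) K) - b • 1) = 0 ∧
      ∀ c : K, (X₀ : Matrix (Fin 3) (Fin 3) K) ≠ c • 1) :
    ∃ U ∈ 𝓝 X₀, ∫⁻ X in U,
      ((NNReal.sqrt (NNReal.sqrt (IsNonarchimedeanLocalField.normAbs K (Matrix.charpoly (X : Matrix (Fin 3) (Fin 3) K)).discr)) : ℝ≥0∞))⁻¹ ∂μ < ∞ := by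
  obtain ⟨a, b, hab, hmin, hns⟩ := hss
  haveI : Invertible (2 : K) := invertibleOfNonzero h2
  have hS : ((X₀ : Matrix (Fin 3) (Fin 3) K).map σ)ᵀ * J + J * (X₀ : Matrix (Fin 3) (Fin 3) K) = 0 := (h𝔲 _).1 X₀.2
  obtain ⟨g, hg, hor, d, hd, hgJ⟩ := exists_isUnit_conj_eq_diagonal_and_congr_diagonal σ hσ hJσ hJd hS hab hmin hns
  rcases hor with h | h
  · exact exists_nhds_setLIntegral_etaInv_lt_top_of_normalFormBasis σ hσ hσc hJd h2 lam hlam 𝔲 h𝔲 μ ι hι hιr hιn X₀ hab hmin hg h hd hgJ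
  · refine exists_nhds_setLIntegral_etaInv_lt_top_of_normalFormBasis σ hσ hσc hJd h2 lam hlam 𝔲 h𝔲 μ ι hι hιr hιn X₀ hab.symm ?_ hg h hd hgJ
    rw [sub_smul_one_mul_sub_smul_one]; exact hmin

/-- **THE `hss` BINDER OF ★ GLOBAL-FINAL, TOKEN FOR TOKEN** (on the trace-zero part `↥𝔲₀`, ANY Haar `μ₀`; an auxiliary Haar `μ` on `↥𝔲` as in GLOBAL-FINAL's binders, `3 ≠ 0`):
at every split-semisimple non-scalar `X₀ ∈ 𝔲₀`, `ηι` has finite `∫⁻` on a neighbourhood of `X₀` in `↥𝔲₀` — `exists_nhds_setLIntegral_etaInv_lt_top_of_isSplitSemisimple` on `↥𝔲`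
carried down by ★ DESCENT `exists_nhds_setLIntegral_etaInv_lt_top_traceZero_of_lie`.
[cite: HarishChandra1970, Part VII §1 Thm. 15] [cite: Folland1999, §11.1 Thm. 11.9] -/
theorem forall_exists_nhds_setLIntegral_etaInv_lt_top_traceZero_of_isSplitSemisimple
    (σ : K →+* K) (hσ : ∀ x, σ (σ x) = x) (hσc : Continuous σ)
    {J : Matrix (Fin 3) (Fin 3) K} (hJσ : (J.map σ)ᵀ = J) (hJd : IsUnit J.det) (h2 : (2 : K) ≠ 0) (h3 : (3 : K) ≠ 0)
    (lam : Kˣ) (hlam : σ (lam : K) = -(lam : K))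
    (𝔲 : AddSubgroup (Matrix (Fin 3) (Fin 3) K)) (h𝔲 : ∀ X, X ∈ 𝔲 ↔ (X.map σ)ᵀ * J + J * X = 0)
    (𝔲₀ : AddSubgroup (Matrix (Fin 3) (Fin 3) K)) (h𝔲₀ : ∀ X, X ∈ 𝔲₀ ↔ (X.map σ)ᵀ * J + J * X = 0 ∧ Matrix.trace X = 0)
    [MeasurableSpace ↥𝔲₀] [BorelSpace ↥𝔲₀] (μ₀ : Measure ↥𝔲₀) [μ₀.IsAddHaarMeasure]
    [MeasurableSpace ↥𝔲] [BorelSpace ↥𝔲] (μ : Measure ↥𝔲) [μ.IsAddHaarMeasure]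
    {F' : Type*} [Field F'] [ValuativeRel F'] [TopologicalSpace F'] [IsNonarchimedeanLocalField F']
    (ι : F' →+* K) (hι : IsClosedEmbedding ι) (hιr : ∀ x, σ x = x ↔ x ∈ Set.range ι)
    (hιn : ∀ x : F', IsNonarchimedeanLocalField.normAbs K (ι x) = IsNonarchimedeanLocalField.normAbs F' x ^ 2) :
    ∀ X₀ : ↥𝔲₀, (∃ a b : K, a ≠ b ∧ ((X₀ : Matrix (Fin 3) (Fin 3) K) - a • (1 : Matrix (Fin 3) (Fin 3) K)) * ((X₀ : Matrix (Fin 3) (Fin 3) K) - b • 1) = 0 ∧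
        ∀ c : K, (X₀ : Matrix (Fin 3) (Fin 3) K) ≠ c • 1) →
      ∃ U ∈ 𝓝 X₀, ∫⁻ X in U,
        ((NNReal.sqrt (NNReal.sqrt (IsNonarchimedeanLocalField.normAbs K (Matrix.charpoly (X : Matrix (Fin 3) (Fin 3) K)).discr)) : ℝ≥0∞))⁻¹ ∂μ₀ < ∞ := by
  intro X₀ hX₀
  exact exists_nhds_setLIntegral_etaInv_lt_top_traceZero_of_lie hσc hJd h3 𝔲 h𝔲 𝔲₀ h𝔲₀ μ₀ μ X₀
    (exists_nhds_setLIntegral_etaInv_lt_top_of_isSplitSemisimple σ hσ hσc hJσ hJd h2 lam hlam 𝔲 h𝔲 μ ι hι hιr hιn _ hX₀)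

end Summit.HodgeConjecture.HodgeConjecture.Cruxes.H413.F0P3cStCharTSHCDescentSemisimpleFinal

end
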